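import Literature.MathematicalPhysics.QuantumFieldTheory.Balaban1983to89.B11Eq90V0Derivative
import Literature.MathematicalPhysics.QuantumFieldTheory.Balaban1983to89.B11Eq37NormBound

/-!
# `Balaban1983to89.B11Eq36Complex` — T. Bałaban, *The variational problem and background fields in renormalization group method for lattice gauge theories*, Commun. Math. Phys. **102** (1985) 277–309 [Balaban1985Variational]: p. 282 «We consider these functions for A belonging to the complexified Lie algebra» — the tree's Hermitian identification (36) `B11Eq26ActionExpansion.V3p_eq_eq36` EXTENDED TO ALL OF 𝔤ᶜ by the identity theorem, hence (29)/(30) and the first member of (40) for the genuine `V₀(A, ∂p)` at COMPLEX configurations, and p. 291's derivative sentence FOR `V′₀` PROPER (the `h40` of `B11Eq90V0Derivative.norm_deriv_le_of_majorant40` DISCHARGED)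

statement-level skeleton of published theorems with citation tags; proofs where landed; nothing here is a claim about the Yang–Mills mass gap

PDF held: `paper:balaban1985-cmp102-variational-background` (journal page = PDF page + 276); pp. 282–284, 291 read by this seat from the
`lit read` text layer, displays as transcribed (render-read) in `B11Eq26ActionExpansion`, `B11Eq34BCH`, `B11Eq37NormBound`,
`B11Eq85FirstDerivative`.

CITATION HEADER (lean-in-tree rule 2026-08-18).  WHAT IS REPRODUCED: the scope sentence of Sect. B for (29)–(40) — p. 282, after
(30): *«where V^{(3)}(A) is a third order polynomial and the expansion of V₄(A) begins with a fourth order polynomial. We consider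
these functions for A belonging to the complexified Lie algebra. A bound for V₄ can be easily obtained.»* — applied to rows
`B11.Eq34`/`B11.Eq37` of reader r08's `ROWS-B11.md`: the tree proves (36) (`B11Eq26ActionExpansion.V3p_eq_eq36`: «(30)'s `V⁽³⁾(A, ∂p)`
IS THE VERBATIM (36)») for HERMITIAN `A` only (its HONEST SCOPE (ii)); (37)/(40) (`B11Eq37NormBound`) are proved for the abstract
polynomial `B11Eq34BCH.V3` with (29) as the hypothesis `h29`.  THIS FILE removes the Hermitian restriction, so that (29)+(36), (37)
and (40) hold for the GENUINE per-plaquette objects `V0p`, `V3p`, `V4p` of `B11Eq26ActionExpansion` at every configuration with values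
in 𝔤ᶜ — print's setting, and the one in which Proposition 4 (p. 292: «on the space of configurations A′ with values in the
complexified Lie algebra 𝔤ᶜ») and the Cauchy estimates of `B11Eq90V0Derivative` operate.

THE PRINT, verbatim.  p. 283 (35)–(36) and p. 284 (39)–(40) as quoted in `B11Eq34BCH` / `B11Eq37NormBound`; p. 284 (40), first member:
*«|V′₀(A, ∂p)| ≦ (|A|(∂p))³ηC₁B₃ε₁(Lʲη)⁻² + (2/4!)(|A|(∂p))⁴»*; p. 291: *«The derivative ((∂/∂A(b))V′₀)(A, ∂p) satisfies a bound
similar to the bound (40) for the function V′₀(A, ∂p), but with the power of |A| lower by 1, and with a different absolute constant.»*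

THE MECHANISM (print gives none; this file's).  Write `A = H + iK` with `H`, `K` Hermitian (Mathlib `realPart` / `imaginaryPart` of a
star module over `ℂ`).  Along the complex line `z ↦ H + zK` both `V⁽³⁾(H + zK, ∂p)` (the symmetrised degree-3 component `V3p`, a
polynomial in the letters) and the verbatim (36) polynomial `B11Eq34BCH.V3` at the letters of `H + zK` are ENTIRE functions of `z`;
they agree for every REAL `z` (`H + zK` is Hermitian there, `V3p_eq_eq36`); by the identity theorem (Mathlib
`AnalyticOnNhd.eq_of_frequently_eq`) they agree for all `z`, in particular at `z = i`, i.e. at `A`.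

WHAT IS CERTIFIED (kernel, sorry-free; axioms `propext` / `Classical.choice` / `Quot.sound`).  Carrier: [5]'s abstract finite lattice
of `B9Eq39Adjoint` (sites `S`, directions `ι`, shifts `T`, background units `U`), `𝔸` a complete normed `ℂ`-`*`-algebra with
`StarModule ℂ 𝔸`, UNITARY background (`U(b)⁻¹ = U(b)*`), a continuous tracial `*`-trace `τ`, `η ≠ 0` — the hypotheses of `V3p_eq_eq36`
MINUS «A Hermitian».
§1 `differentiable_V3`, `differentiable_V3p`, `differentiable_V3_letters` (both sides are entire in `A`); §2 `star_line` (`H + tK` is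
   Hermitian for real `t`).
§3 **`V3p_eq_eq36_complex`** — (36) FOR EVERY `A : ι → S → 𝔸`: `V⁽³⁾(A, ∂p) = B11Eq34BCH.V3 τ (DA)(p) A′(b₁) … A′(b₄) (Re U₀(∂p))
   (η⁻² Im U₀(∂p)) η` (complexified `Re`/`Im` of [5] p. 391).
§4 **`V0p_eq29_complex`** — (29)/(30) with (36) substituted, at complex `A` (the `h29` of `B11Eq37NormBound.ineq40_first` DISCHARGED for
   the genuine objects); **`ineq37_first_complex`** ((37), first member, for the genuine `V3p` at complex `A`); **`ineq40_first_complex`** — (40), first member, FOR THE GENUINE `V′₀(A, ∂p) := V₀(A, ∂p) −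
   ½ i tr((DA)(p)Σ_{b₁≺b₂}[A′(b₁), A′(b₂)])` AT COMPLEX `A`: `|V′₀(A, ∂p)| ≦ S³ηκ + (2/4!)S⁴` for `|A|(∂p) ≦ S`, `e^{ηS} ≦ 2` (print's
   «32ε₂ ≦ 1 … e^{η|A|(∂p)} < 2»), under the trace-slot bounds of (38)/(31) (`hRe1`: `|tr(Z(Re U₀(∂p) − 1))| ≦ |Z|η²κ`, `κ = C₁B₃ε₁(Lʲη)⁻²`;
   `hIm`: `|tr(Z η⁻² Im U₀(∂p))| ≦ |Z|κ`; `hW`/`hW'`: `|tr(Z U₀(∂p)^{±1})| ≦ |Z|`), with (33) supplied by `ineq31_V4p`;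
   `exp_le_two_of_32` + **`ineq40_printed_complex`** — (40) AS PRINTED `< 64ε₂³(C₁B₃ε₁ + ε₂)(Lʲη)⁻⁴` under (32), «32ε₂ ≦ 1».
§5 **`norm_deriv_V0prime_line_le` — p. 291's SENTENCE FOR `V′₀` PROPER**: for `|A|(∂p) ≦ s`, `|δA|(∂p) ≦ Δ`, `0 < s`, `0 < Δ`,
   `e^{2ηs} ≦ 2`: `|(d/dt)V′₀(A + tδA, ∂p)|_{t=0}| ≦ Δ(8s²ηκ + (4/3)s³)` — §4 on the circle `|t| = s/Δ` is EXACTLY the hypothesis `h40` of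
   `B11Eq90V0Derivative.norm_deriv_le_of_majorant40`; **`ineq90_V0prime`** — fed BY NAME into `B11Eq90V0Derivative.ineq90_of_deriv40`
   (`κ = C₁B₃ε₁(Lʲη)⁻²`): (90)'s «O(1)ε₃²(ε₁ + ε₃)(Lʲη)⁻³» for the V′₀-group with `K₀ = 128Δ`.

HONEST SCOPE — what is NOT claimed.  (i) Hypotheses are print's: unitary background, tracial `*`-trace, `η ≠ 0`; the trace-slot bounds
`hRe1`/`hIm`/`hW`/`hW'` are (38) (= the background regularity (14)) and the normalised-trace Hölder facts — HYPOTHESES here exactly as in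
`B11Eq37NormBound` / `B11Eq26ActionExpansion.ineq31_V4p`; nothing of (14) is derived.  (ii) The composition with `A′ ↦ A′ − HD(A′)` and the
operator `𝔇*(A′)H*` of (90) are not touched (`n = #st(b)`, `θ` enter `ineq90_V0prime` as letters).  (iii) [5]'s abstract carrier and
sizes (DIVERGENCE D-pv27.4 inherited); constants `8`, `4/3`, `128` are witnesses of print's «different absolute constant» / «O(1)».  (iv) No
`def`, no new named fact; theorem-only.  Unit `b2b-balaban-t4-ne9-formalise-leaf-05` (cell `pub-balaban`, NE9 crux-team leaf prover,
gen 63; companion of `B11Eq90V0Derivative`, letter (L3) inner content).  Imports `B11Eq90V0Derivative`, `B11Eq37NormBound` ONLY;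
modifies nothing of r08's.
-/

noncomputable section

open NormedSpace Complex Metric Set Finset Filter Topology ComplexStarModule
open scoped Nat

namespace Literature.MathematicalPhysics.QuantumFieldTheory.Balaban1983to89.B11Eq36Complex

open Literature.MathematicalPhysics.QuantumFieldTheory.Balaban1983to89
open Literature.MathematicalPhysics.QuantumFieldTheory.Balaban1983to89.Beta.TransportVertices
open Literature.MathematicalPhysics.QuantumFieldTheory.Balaban1983to89.Beta.AdjointTransportJets
open Literature.MathematicalPhysics.QuantumFieldTheory.Balaban1983to89.B9Eq37Insertion
open Literature.MathematicalPhysics.QuantumFieldTheory.Balaban1983to89.B9Eq39Adjoint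
open Literature.MathematicalPhysics.QuantumFieldTheory.Balaban1983to89.B11Eq26ActionExpansion
open Literature.MathematicalPhysics.QuantumFieldTheory.Balaban1983to89.B11Eq90V0Derivative

variable {𝔸 : Type*} [NormedRing 𝔸] [NormedAlgebra ℂ 𝔸] [CompleteSpace 𝔸]

/-! ## §1 Both sides of (36) are entire functions of the configuration -/

omit [CompleteSpace 𝔸] in
/-- The degree-3 component as a polynomial: `B11Eq31V4Bound.grade4 3 = (1/12)·B11Eq34BCH.prod3` (`B11Eq31V4Bound.twelve_smul_grade4_three_complex`).
[cite: Balaban1985Variational, (34)-(35) p.283] -/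
theorem grade4_three_eq (a b c d : 𝔸) : B11Eq31V4Bound.grade4 a b c d 3 = (12 : ℂ)⁻¹ • B11Eq34BCH.prod3 a b c d := by
  rw [← B11Eq31V4Bound.twelve_smul_grade4_three_complex, inv_smul_smul₀ (by norm_num : (12 : ℂ) ≠ 0)]

omit [CompleteSpace 𝔸] in
/-- `B11Eq34BCH.prod3` of differentiable letters is differentiable. [folklore] [cite: Balaban1985Variational, (34) p.283] -/
theorem differentiable_prod3 {E : Type*} [NormedAddCommGroup E] [NormedSpace ℂ E] {a b c d : E → 𝔸}
    (ha : Differentiable ℂ a) (hb : Differentiable ℂ b) (hc : Differentiable ℂ c) (hd : Differentiable ℂ d) :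
    Differentiable ℂ (fun Y => B11Eq34BCH.prod3 (a Y) (b Y) (c Y) (d Y)) := by
  unfold B11Eq34BCH.prod3
  fun_prop

omit [CompleteSpace 𝔸] in
/-- The verbatim (36) polynomial `B11Eq34BCH.V3` of differentiable arguments is differentiable («V^{(3)}(A) is a third order
polynomial», p. 282). [cite: Balaban1985Variational, (36) pp.283-284, p.282] -/
theorem differentiable_V3 {E : Type*} [NormedAddCommGroup E] [NormedSpace ℂ E] (τ : 𝔸 →L[ℂ] ℂ) {D a b c d : E → 𝔸}
    (hD : Differentiable ℂ D) (ha : Differentiable ℂ a) (hb : Differentiable ℂ b) (hc : Differentiable ℂ c)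
    (hd : Differentiable ℂ d) (ReU ImU2 : 𝔸) (η : ℝ) :
    Differentiable ℂ (fun Y => B11Eq34BCH.V3 (τ : 𝔸 →ₗ[ℂ] ℂ) (D Y) (a Y) (b Y) (c Y) (d Y) ReU ImU2 η) := by
  have hτ : Differentiable ℂ (fun X : 𝔸 => (τ : 𝔸 →ₗ[ℂ] ℂ) X) := τ.differentiable
  unfold B11Eq34BCH.V3 B11Eq34BCH.comm2 B11Eq34BCH.comm3pair B11Eq34BCH.comm3triple
  simp only [Ring.lie_def]
  fun_prop

variable {S : Type*} [Fintype S] {ι : Type*} [Fintype ι] [LinearOrder ι]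
variable (T : ι → Equiv.Perm S) (U : ι → S → 𝔸ˣ)

omit [CompleteSpace 𝔸] [LinearOrder ι] in
/-- **`V⁽³⁾(A, ∂p)` IS ENTIRE IN `A`** (the symmetrised degree-3 component `B11Eq26ActionExpansion.V3p`, a polynomial in the four
letters). [cite: Balaban1985Variational, (30) p.282, (35) p.283] -/
theorem differentiable_V3p (η : ℝ) (τ : 𝔸 →L[ℂ] ℂ) (μ ν : ι) (x : S) :
    Differentiable ℂ (fun A : ι → S → 𝔸 => V3p T U η (τ : 𝔸 →ₗ[ℂ] ℂ) A μ ν x) := by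
  have hR1 := differentiable_R (U ν x)
  have hR2 := differentiable_R (U μ x)
  have hτ : Differentiable ℂ (fun X : 𝔸 => (τ : 𝔸 →ₗ[ℂ] ℂ) X) := τ.differentiable
  unfold V3p
  simp only [grade4_three_eq, Y]
  simp only [Matrix.cons_val_zero, Matrix.cons_val_one, Matrix.cons_val]
  have h1 : Differentiable ℂ (fun A : ι → S → 𝔸 =>
      B11Eq34BCH.prod3 ((I * ↑η) • -R (U ν x) (A μ ((T ν) x))) ((I * ↑η) • -A ν x) ((I * ↑η) • A μ x)
        ((I * ↑η) • R (U μ x) (A ν ((T μ) x)))) := by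
    apply differentiable_prod3 <;> fun_prop
  have h2 : Differentiable ℂ (fun A : ι → S → 𝔸 =>
      B11Eq34BCH.prod3 (-((I * ↑η) • R (U μ x) (A ν ((T μ) x)))) (-((I * ↑η) • A μ x)) (-((I * ↑η) • -A ν x))
        (-((I * ↑η) • -R (U ν x) (A μ ((T ν) x))))) := by
    apply differentiable_prod3 <;> fun_prop
  fun_prop

omit [CompleteSpace 𝔸] [LinearOrder ι] in
/-- The plaquette derivative `(DA)(p)` (`B9Eq39Adjoint.curlη`) is differentiable (indeed linear) in `A`. [folklore]
[cite: Balaban1985Variational, (25) p.282] -/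
theorem differentiable_curlη (η : ℝ) (μ ν : ι) (x : S) :
    Differentiable ℂ (fun A : ι → S → 𝔸 => curlη T U η A μ ν x) := by
  have hR1 := differentiable_R (U ν x)
  have hR2 := differentiable_R (U μ x)
  unfold curlη curl covD
  fun_prop

omit [CompleteSpace 𝔸] [LinearOrder ι] in
/-- The verbatim (36) polynomial AT THE LETTERS OF `A` (`D = (DA)(p)`, `A′(b₁) … A′(b₄)` of `B9Eq39Adjoint.lettersA`) is entire in
`A`. [cite: Balaban1985Variational, (36) pp.283-284] -/
theorem differentiable_V3_letters (η : ℝ) (τ : 𝔸 →L[ℂ] ℂ) (μ ν : ι) (x : S) (ReU ImU2 : 𝔸) :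
    Differentiable ℂ (fun A : ι → S → 𝔸 => B11Eq34BCH.V3 (τ : 𝔸 →ₗ[ℂ] ℂ) (curlη T U η A μ ν x)
      (-(R (U ν x) (A μ (T ν x)))) (-(A ν x)) (A μ x) (R (U μ x) (A ν (T μ x))) ReU ImU2 η) := by
  have hR1 := differentiable_R (U ν x)
  have hR2 := differentiable_R (U μ x)
  exact differentiable_V3 τ (differentiable_curlη T U η μ ν x) (by fun_prop) (by fun_prop) (by fun_prop)
    (by fun_prop) ReU ImU2 η

/-! ## §2–§3 (36) on the complexified Lie algebra -/

variable [StarRing 𝔸] [StarModule ℂ 𝔸]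

omit [CompleteSpace 𝔸] [Fintype S] [Fintype ι] [LinearOrder ι] in
/-- For Hermitian configurations `H`, `K` and REAL `t`, the configuration `H + tK` is Hermitian. [folklore]
[cite: Balaban1985Variational, p.282] -/
theorem star_line {H K : ι → S → 𝔸} (hH : ∀ μ x, star (H μ x) = H μ x) (hK : ∀ μ x, star (K μ x) = K μ x)
    (t : ℝ) (μ : ι) (x : S) : star ((H + (t : ℂ) • K) μ x) = (H + (t : ℂ) • K) μ x := by
  simp only [Pi.add_apply, Pi.smul_apply, star_add, star_smul, hH, hK, Complex.star_def, Complex.conj_ofReal]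

omit [LinearOrder ι] in
/-- **(36) ON THE COMPLEXIFIED LIE ALGEBRA** («We consider these functions for A belonging to the complexified Lie algebra», p. 282):
for EVERY configuration `A` (no Hermitian hypothesis), a unitary background, a continuous tracial `*`-trace and `η ≠ 0`,
`V⁽³⁾(A, ∂p) = B11Eq34BCH.V3 τ (DA)(p) A′(b₁) A′(b₂) A′(b₃) A′(b₄) (Re U₀(∂p)) (η⁻² Im U₀(∂p)) η` — the tree's Hermitian
`V3p_eq_eq36` continued to 𝔤ᶜ along `z ↦ ℜA + zℑA` by the identity theorem.
[cite: Balaban1985Variational, (36) pp.283-284, (30) p.282] -/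
theorem V3p_eq_eq36_complex (hU : ∀ μ x, (((U μ x)⁻¹ : 𝔸ˣ) : 𝔸) = star (U μ x : 𝔸))
    (τ : 𝔸 →L[ℂ] ℂ) (hτ : ∀ a b : 𝔸, τ (a * b) = τ (b * a)) (hτs : ∀ a : 𝔸, τ (star a) = starRingEnd ℂ (τ a))
    {η : ℝ} (hη : η ≠ 0) (A : ι → S → 𝔸) (μ ν : ι) (x : S) :
    V3p T U η (τ : 𝔸 →ₗ[ℂ] ℂ) A μ ν x
      = B11Eq34BCH.V3 (τ : 𝔸 →ₗ[ℂ] ℂ) (curlη T U η A μ ν x) (-(R (U ν x) (A μ (T ν x)))) (-(A ν x)) (A μ x)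
          (R (U μ x) (A ν (T μ x))) (reC (plaqU T U μ ν x)) (((η : ℂ) ^ 2)⁻¹ • imC (plaqU T U μ ν x)) η := by
  -- `A = H + iK`, `H`, `K` Hermitian
  set H : ι → S → 𝔸 := fun κ y => ((ℜ (A κ y) : selfAdjoint 𝔸) : 𝔸) with hHdef
  set K : ι → S → 𝔸 := fun κ y => ((ℑ (A κ y) : selfAdjoint 𝔸) : 𝔸) with hKdef
  have hH : ∀ κ y, star (H κ y) = H κ y := fun κ y => (ℜ (A κ y)).prop
  have hK : ∀ κ y, star (K κ y) = K κ y := fun κ y => (ℑ (A κ y)).prop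
  have hA : A = H + I • K := by
    funext κ y
    exact (realPart_add_I_smul_imaginaryPart (A κ y)).symm
  -- both sides along the complex line `z ↦ H + zK` are entire
  set f : ℂ → ℂ := fun z => V3p T U η (τ : 𝔸 →ₗ[ℂ] ℂ) (H + z • K) μ ν x with hf
  set g : ℂ → ℂ := fun z => B11Eq34BCH.V3 (τ : 𝔸 →ₗ[ℂ] ℂ) (curlη T U η (H + z • K) μ ν x)
      (-(R (U ν x) ((H + z • K) μ (T ν x)))) (-((H + z • K) ν x)) ((H + z • K) μ x)
      (R (U μ x) ((H + z • K) ν (T μ x))) (reC (plaqU T U μ ν x))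
      (((η : ℂ) ^ 2)⁻¹ • imC (plaqU T U μ ν x)) η with hg
  have hfd : Differentiable ℂ f := (differentiable_V3p T U η τ μ ν x).comp (by fun_prop)
  have hgd : Differentiable ℂ g :=
    (differentiable_V3_letters T U η τ μ ν x (reC (plaqU T U μ ν x))
      (((η : ℂ) ^ 2)⁻¹ • imC (plaqU T U μ ν x))).comp (by fun_prop)
  -- they agree on the real axis: there `H + tK` is Hermitian and the tree's (36) applies
  have hreal : ∀ t : ℝ, f t = g t := fun t =>
    V3p_eq_eq36 T U hU (τ : 𝔸 →ₗ[ℂ] ℂ) hτ hτs hη (star_line hH hK t) μ ν x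
  -- identity theorem
  have hfg : f = g := by
    refine AnalyticOnNhd.eq_of_frequently_eq (z₀ := 0) (fun z _ => hfd.analyticAt z)
      (fun z _ => hgd.analyticAt z) ?_
    have ht : Tendsto (fun t : ℝ => (t : ℂ)) (𝓝[≠] 0) (𝓝[≠] 0) :=
      tendsto_nhdsWithin_of_tendsto_nhds_of_eventually_within _
        ((Complex.continuous_ofReal.tendsto' 0 0 Complex.ofReal_zero).mono_left nhdsWithin_le_nhds)
        (eventually_mem_nhdsWithin.mono fun t ht => by simpa using ht)
    exact ht.frequently (Frequently.of_forall hreal)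
  have key := congrFun hfg I
  simp only [hf, hg] at key
  rw [hA]
  exact key

/-! ## §4 (29)/(30) and (40) for the genuine objects at complex configurations -/

omit [LinearOrder ι] in
/-- **(29)/(30) WITH (36) SUBSTITUTED, AT COMPLEX `A`**: `V₀(A, ∂p) = [verbatim (36) at the letters of A] + V₄(A, ∂p)` — the hypothesis
`h29` of `B11Eq37NormBound.ineq40_first` for the genuine `V0p`/`V4p`. [cite: Balaban1985Variational, (29)-(30) p.282, (36) pp.283-284] -/
theorem V0p_eq29_complex (hU : ∀ μ x, (((U μ x)⁻¹ : 𝔸ˣ) : 𝔸) = star (U μ x : 𝔸))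
    (τ : 𝔸 →L[ℂ] ℂ) (hτ : ∀ a b : 𝔸, τ (a * b) = τ (b * a)) (hτs : ∀ a : 𝔸, τ (star a) = starRingEnd ℂ (τ a))
    {η : ℝ} (hη : η ≠ 0) (A : ι → S → 𝔸) (μ ν : ι) (x : S) :
    V0p T U η (τ : 𝔸 →ₗ[ℂ] ℂ) A μ ν x
      = B11Eq34BCH.V3 (τ : 𝔸 →ₗ[ℂ] ℂ) (curlη T U η A μ ν x) (-(R (U ν x) (A μ (T ν x)))) (-(A ν x)) (A μ x)
          (R (U μ x) (A ν (T μ x))) (reC (plaqU T U μ ν x)) (((η : ℂ) ^ 2)⁻¹ • imC (plaqU T U μ ν x)) η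
        + V4p T U η (τ : 𝔸 →ₗ[ℂ] ℂ) A μ ν x := by
  rw [eq30b, V3p_eq_eq36_complex T U hU τ hτ hτs hη A μ ν x]

omit [LinearOrder ι] in
/-- **(37), FIRST MEMBER, FOR THE GENUINE `V⁽³⁾(A, ∂p)` AT COMPLEX `A`** — «|V^{(3)}(A, ∂p)| ≦ ½|(DA)(p)|(|A|(∂p))² +
½η(|A|(∂p))³C₁B₃ε₁(Lʲη)⁻²»: for `|A|(∂p) ≦ s`, `|(DA)(p)| ≦ δ`, under the trace-slot bounds `|tr(Z Re U₀(∂p))| ≦ |Z|`,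
`|tr(Z η⁻² Im U₀(∂p))| ≦ |Z|κ`: `|V⁽³⁾(A, ∂p)| ≦ ½δs² + ½ηs³κ` (`B11Eq37NormBound.norm_V3_le` through `V3p_eq_eq36_complex`).
[cite: Balaban1985Variational, (37) p.284, (36) pp.283-284] -/
theorem ineq37_first_complex (hU : ∀ μ x, (((U μ x)⁻¹ : 𝔸ˣ) : 𝔸) = star (U μ x : 𝔸))
    (τ : 𝔸 →L[ℂ] ℂ) (hτ : ∀ a b : 𝔸, τ (a * b) = τ (b * a)) (hτs : ∀ a : 𝔸, τ (star a) = starRingEnd ℂ (τ a))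
    {η : ℝ} (hη : 0 < η) {κ s δ : ℝ} (hκ : 0 ≤ κ) (A : ι → S → 𝔸) (μ ν : ι) (x : S)
    (hS : size (lettersA T U A μ ν x) ≤ s) (hD : ‖curlη T U η A μ ν x‖ ≤ δ)
    (hRe : ∀ Z : 𝔸, ‖(τ : 𝔸 →ₗ[ℂ] ℂ) (Z * reC (plaqU T U μ ν x))‖ ≤ ‖Z‖)
    (hIm : ∀ Z : 𝔸, ‖(τ : 𝔸 →ₗ[ℂ] ℂ) (Z * (((η : ℂ) ^ 2)⁻¹ • imC (plaqU T U μ ν x)))‖ ≤ ‖Z‖ * κ) :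
    ‖V3p T U η (τ : 𝔸 →ₗ[ℂ] ℂ) A μ ν x‖ ≤ 1 / 2 * δ * s ^ 2 + 1 / 2 * η * s ^ 3 * κ := by
  have hsum : ‖R (U ν x) (A μ (T ν x))‖ + ‖A ν x‖ + ‖A μ x‖ + ‖R (U μ x) (A ν (T μ x))‖ ≤ s := by
    rw [← size_lettersA]; exact hS
  have h₁ : ‖-(R (U ν x) (A μ (T ν x)))‖ ≤ ‖R (U ν x) (A μ (T ν x))‖ := by rw [norm_neg]
  have h₂ : ‖-(A ν x)‖ ≤ ‖A ν x‖ := by rw [norm_neg]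
  have hηD : η * ‖curlη T U η A μ ν x‖ ≤ s := by
    rw [curlη, norm_smul, norm_inv, Complex.norm_real, Real.norm_of_nonneg hη.le, ← mul_assoc,
      mul_inv_cancel₀ hη.ne', one_mul, ← sum_lettersA]
    exact (norm_sum_le_size _).trans hS
  rw [V3p_eq_eq36_complex T U hU τ hτ hτs hη.ne' A μ ν x]
  exact B11Eq37NormBound.norm_V3_le h₁ h₂ le_rfl le_rfl hsum hD hηD hη.le hκ hRe hIm

omit [LinearOrder ι] in
/-- **(40), FIRST MEMBER, FOR THE GENUINE `V′₀(A, ∂p)` AT COMPLEX `A`**: with `V′₀(A, ∂p) := V₀(A, ∂p) − ½ i tr((DA)(p)Σ_{b₁≺b₂}[A′(b₁),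
A′(b₂)])` ((39)), for `|A|(∂p) ≦ S` and `e^{ηS} ≦ 2`, under the trace-slot bounds (38)/(31):
`|V′₀(A, ∂p)| ≦ S³ηκ + (2/4!)S⁴` (`B11Eq37NormBound.ineq40_first` with `h29 := V0p_eq29_complex`, `h33 := ineq31_V4p`).
[cite: Balaban1985Variational, (40) p.284, (39) p.284, (31) p.282] -/
theorem ineq40_first_complex [NormOneClass 𝔸] (hU : ∀ μ x, (((U μ x)⁻¹ : 𝔸ˣ) : 𝔸) = star (U μ x : 𝔸))
    (τ : 𝔸 →L[ℂ] ℂ) (hτ : ∀ a b : 𝔸, τ (a * b) = τ (b * a)) (hτs : ∀ a : 𝔸, τ (star a) = starRingEnd ℂ (τ a))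
    {η : ℝ} (hη : 0 < η) {κ s : ℝ} (hκ : 0 ≤ κ) (A : ι → S → 𝔸) (μ ν : ι) (x : S)
    (hS : size (lettersA T U A μ ν x) ≤ s) (hexp : Real.exp (η * s) ≤ 2)
    (hRe1 : ∀ Z : 𝔸, ‖(τ : 𝔸 →ₗ[ℂ] ℂ) (Z * (reC (plaqU T U μ ν x) - 1))‖ ≤ ‖Z‖ * (η ^ 2 * κ))
    (hIm : ∀ Z : 𝔸, ‖(τ : 𝔸 →ₗ[ℂ] ℂ) (Z * (((η : ℂ) ^ 2)⁻¹ • imC (plaqU T U μ ν x)))‖ ≤ ‖Z‖ * κ)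
    (hW : ∀ Z : 𝔸, ‖(τ : 𝔸 →ₗ[ℂ] ℂ) (Z * (plaqU T U μ ν x : 𝔸))‖ ≤ ‖Z‖)
    (hW' : ∀ Z : 𝔸, ‖(τ : 𝔸 →ₗ[ℂ] ℂ) (Z * (((plaqU T U μ ν x)⁻¹ : 𝔸ˣ) : 𝔸))‖ ≤ ‖Z‖) :
    ‖V0p T U η (τ : 𝔸 →ₗ[ℂ] ℂ) A μ ν x - (2 : ℂ)⁻¹ * I * (τ : 𝔸 →ₗ[ℂ] ℂ) (curlη T U η A μ ν x
        * B11Eq34BCH.comm2 (-(R (U ν x) (A μ (T ν x)))) (-(A ν x)) (A μ x) (R (U μ x) (A ν (T μ x))))‖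
      ≤ s ^ 3 * η * κ + 2 / 24 * s ^ 4 := by
  have hsum : ‖R (U ν x) (A μ (T ν x))‖ + ‖A ν x‖ + ‖A μ x‖ + ‖R (U μ x) (A ν (T μ x))‖ ≤ s := by
    rw [← size_lettersA]; exact hS
  have h₁ : ‖-(R (U ν x) (A μ (T ν x)))‖ ≤ ‖R (U ν x) (A μ (T ν x))‖ := by rw [norm_neg]
  have h₂ : ‖-(A ν x)‖ ≤ ‖A ν x‖ := by rw [norm_neg]
  have hηD : η * ‖curlη T U η A μ ν x‖ ≤ s := by
    rw [curlη, norm_smul, norm_inv, Complex.norm_real, Real.norm_of_nonneg hη.le, ← mul_assoc,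
      mul_inv_cancel₀ hη.ne', one_mul, ← sum_lettersA]
    exact (norm_sum_le_size _).trans hS
  have hτc : (τ : 𝔸 →ₗ[ℂ] ℂ) (B11Eq34BCH.comm2 (-(R (U ν x) (A μ (T ν x)))) (-(A ν x)) (A μ x) (R (U μ x) (A ν (T μ x)))
        * curlη T U η A μ ν x)
      = (τ : 𝔸 →ₗ[ℂ] ℂ) (curlη T U η A μ ν x
        * B11Eq34BCH.comm2 (-(R (U ν x) (A μ (T ν x)))) (-(A ν x)) (A μ x) (R (U μ x) (A ν (T μ x)))) := hτ _ _
  have h29 := V0p_eq29_complex T U hU τ hτ hτs hη.ne' A μ ν x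
  have h33 : ‖V4p T U η (τ : 𝔸 →ₗ[ℂ] ℂ) A μ ν x‖ ≤ 2 / 24 * s ^ 4 := by
    have h := ineq31_V4p T U (τ : 𝔸 →ₗ[ℂ] ℂ) hτ μ ν x hW hW' hη (A := A) le_rfl le_rfl le_rfl le_rfl
    have hexp' : Real.exp (η * (‖R (U ν x) (A μ (T ν x))‖ + ‖A ν x‖ + ‖A μ x‖ + ‖R (U μ x) (A ν (T μ x))‖)) ≤ 2 :=
      le_trans (Real.exp_le_exp.2 (mul_le_mul_of_nonneg_left hsum hη.le)) hexp
    calc ‖V4p T U η (τ : 𝔸 →ₗ[ℂ] ℂ) A μ ν x‖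
        ≤ 1 / 4 ! * (‖R (U ν x) (A μ (T ν x))‖ + ‖A ν x‖ + ‖A μ x‖ + ‖R (U μ x) (A ν (T μ x))‖) ^ 4
            * Real.exp (η * (‖R (U ν x) (A μ (T ν x))‖ + ‖A ν x‖ + ‖A μ x‖ + ‖R (U μ x) (A ν (T μ x))‖)) := h
      _ ≤ 1 / 4 ! * s ^ 4 * 2 := by gcongr
      _ = 2 / 24 * s ^ 4 := by norm_num [Nat.factorial]; ring
  exact B11Eq37NormBound.ineq40_first h₁ h₂ le_rfl le_rfl hsum hηD hη.le hκ hτc hRe1 hIm h29 h33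

omit [LinearOrder ι] in
/-- Under (32) («32ε₂ ≦ 1»: `|A|(∂p) ≦ σ ≦ 4a`, `a < ε₂(Lʲη)⁻¹`, `η ≦ Lʲη = t`) the exponential factor of (31) is harmless:
`e^{ησ} ≦ 8/7 ≦ 2` («This implies e^{η|A|(∂p)} < e^{4ε₂} < 2», p. 283). [cite: Balaban1985Variational, (32)-(33) pp.282-283] -/
theorem exp_le_two_of_32 {a σ η t ε₂ : ℝ} (ht : 0 < t) (hηt : η ≤ t) (hσ0 : 0 ≤ σ) (hσa : σ ≤ 4 * a)
    (ha : a < ε₂ / t) (h32 : 32 * ε₂ ≤ 1) : Real.exp (η * σ) ≤ 2 := by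
  have hat : t * a < ε₂ := by rwa [lt_div_iff₀ ht, mul_comm] at ha
  have hx1 : η * σ ≤ 1 / 8 := by nlinarith [mul_le_mul hηt hσa hσ0 ht.le]
  calc Real.exp (η * σ) ≤ Real.exp (1 / 8) := Real.exp_le_exp.2 hx1
    _ ≤ 1 / (1 - 1 / 8) := Real.exp_bound_div_one_sub_of_interval (by norm_num) (by norm_num)
    _ ≤ 2 := by norm_num

omit [LinearOrder ι] in
/-- **(40) AS PRINTED, END TO END, FOR THE GENUINE `V′₀(A, ∂p)` AT COMPLEX `A`**: under (32) with `32ε₂ ≦ 1` and the trace-slot bounds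
of (38)/(31) (`κ = K(Lʲη)⁻²`, `K = C₁B₃ε₁ ≧ 0`): `|V′₀(A, ∂p)| < 64ε₂³(C₁B₃ε₁ + ε₂)(Lʲη)⁻⁴` (`ineq40_first_complex` + the further members
`B11Smallness.ineq40`, exactly as `B11Eq37NormBound.ineq40_printed`). [cite: Balaban1985Variational, (40) p.284, (32) p.282] -/
theorem ineq40_printed_complex [NormOneClass 𝔸] (hU : ∀ μ x, (((U μ x)⁻¹ : 𝔸ˣ) : 𝔸) = star (U μ x : 𝔸))
    (τ : 𝔸 →L[ℂ] ℂ) (hτ : ∀ a b : 𝔸, τ (a * b) = τ (b * a)) (hτs : ∀ a : 𝔸, τ (star a) = starRingEnd ℂ (τ a))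
    {η : ℝ} (hη : 0 < η) {K s a t ε₂ : ℝ} (hK : 0 ≤ K) (ht : 0 < t) (hηt : η ≤ t) (ha0 : 0 ≤ a)
    (A : ι → S → 𝔸) (μ ν : ι) (x : S) (hS : size (lettersA T U A μ ν x) ≤ s) (hSa : s ≤ 4 * a) (ha : a < ε₂ / t)
    (h32 : 32 * ε₂ ≤ 1)
    (hRe1 : ∀ Z : 𝔸, ‖(τ : 𝔸 →ₗ[ℂ] ℂ) (Z * (reC (plaqU T U μ ν x) - 1))‖ ≤ ‖Z‖ * (η ^ 2 * (K / t ^ 2)))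
    (hIm : ∀ Z : 𝔸, ‖(τ : 𝔸 →ₗ[ℂ] ℂ) (Z * (((η : ℂ) ^ 2)⁻¹ • imC (plaqU T U μ ν x)))‖ ≤ ‖Z‖ * (K / t ^ 2))
    (hW : ∀ Z : 𝔸, ‖(τ : 𝔸 →ₗ[ℂ] ℂ) (Z * (plaqU T U μ ν x : 𝔸))‖ ≤ ‖Z‖)
    (hW' : ∀ Z : 𝔸, ‖(τ : 𝔸 →ₗ[ℂ] ℂ) (Z * (((plaqU T U μ ν x)⁻¹ : 𝔸ˣ) : 𝔸))‖ ≤ ‖Z‖) :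
    ‖V0p T U η (τ : 𝔸 →ₗ[ℂ] ℂ) A μ ν x - (2 : ℂ)⁻¹ * I * (τ : 𝔸 →ₗ[ℂ] ℂ) (curlη T U η A μ ν x
        * B11Eq34BCH.comm2 (-(R (U ν x) (A μ (T ν x)))) (-(A ν x)) (A μ x) (R (U μ x) (A ν (T μ x))))‖
      < 64 * ε₂ ^ 3 * (K + ε₂) / t ^ 4 := by
  have hS0 : 0 ≤ s := (size_nonneg _).trans hS
  have hκ : 0 ≤ K / t ^ 2 := by positivity
  have hexp : Real.exp (η * s) ≤ 2 := exp_le_two_of_32 ht hηt hS0 hSa ha h32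
  have hfirst := ineq40_first_complex T U hU τ hτ hτs hη hκ A μ ν x hS hexp hRe1 hIm hW hW'
  obtain ⟨c1, c2, c3⟩ := B11Smallness.ineq40 a s η t K ε₂ ht hη.le hηt ha0 hS0 hSa ha hK
  have e : s ^ 3 * η * (K / t ^ 2) + 2 / 24 * s ^ 4 = s ^ 3 * η * K / t ^ 2 + 2 / 24 * s ^ 4 := by ring
  rw [e] at hfirst
  exact lt_of_le_of_lt ((hfirst.trans c1).trans c2) c3

/-! ## §5 p. 291's sentence for `V′₀` proper -/

omit [CompleteSpace 𝔸] [LinearOrder ι] [StarRing 𝔸] [StarModule ℂ 𝔸] in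
/-- The (39) term `½ i tr((DA)(p) Σ_{b₁≺b₂}[A′(b₁), A′(b₂)])` along a complex line is entire in `t` (a cubic polynomial).
[cite: Balaban1985Variational, (39) p.284] -/
theorem differentiable_term39_line (η : ℝ) (τ : 𝔸 →L[ℂ] ℂ) (A δ : ι → S → 𝔸) (μ ν : ι) (x : S) :
    Differentiable ℂ (fun t : ℂ => (2 : ℂ)⁻¹ * I * (τ : 𝔸 →ₗ[ℂ] ℂ) (curlη T U η (A + t • δ) μ ν x
      * B11Eq34BCH.comm2 (-(R (U ν x) ((A + t • δ) μ (T ν x)))) (-((A + t • δ) ν x)) ((A + t • δ) μ x)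
          (R (U μ x) ((A + t • δ) ν (T μ x))))) := by
  have hR1 := differentiable_R (U ν x)
  have hR2 := differentiable_R (U μ x)
  have hτ : Differentiable ℂ (fun X : 𝔸 => (τ : 𝔸 →ₗ[ℂ] ℂ) X) := τ.differentiable
  have hc := differentiable_curlη T U η μ ν x (𝔸 := 𝔸)
  unfold B11Eq34BCH.comm2
  simp only [Ring.lie_def]
  fun_prop

omit [LinearOrder ι] in
/-- **p. 291, THE SENTENCE FOR `V′₀` PROPER** — «The derivative ((∂/∂A(b))V′₀)(A, ∂p) satisfies a bound similar to the bound (40) for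
the function V′₀(A, ∂p), but with the power of |A| lower by 1, and with a different absolute constant»: for `|A|(∂p) ≦ s`,
`|δA|(∂p) ≦ Δ`, `0 < s`, `0 < Δ`, `e^{2ηs} ≦ 2`, under the hypotheses of `ineq40_first_complex`,
`|(d/dt)V′₀(A + tδA, ∂p)|_{t=0}| ≦ Δ(8s²ηκ + (4/3)s³)` — §4 on the circle `|t| = s/Δ` is the `h40` of
`B11Eq90V0Derivative.norm_deriv_le_of_majorant40`. [cite: Balaban1985Variational, (90) p.291, (40) p.284] -/
theorem norm_deriv_V0prime_line_le [NormOneClass 𝔸] (hU : ∀ μ x, (((U μ x)⁻¹ : 𝔸ˣ) : 𝔸) = star (U μ x : 𝔸))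
    (τ : 𝔸 →L[ℂ] ℂ) (hτ : ∀ a b : 𝔸, τ (a * b) = τ (b * a)) (hτs : ∀ a : 𝔸, τ (star a) = starRingEnd ℂ (τ a))
    {η : ℝ} (hη : 0 < η) {κ s Δ : ℝ} (hκ : 0 ≤ κ) (A δ : ι → S → 𝔸) (μ ν : ι) (x : S)
    (hs : size (lettersA T U A μ ν x) ≤ s) (hΔ : size (lettersA T U δ μ ν x) ≤ Δ) (hs0 : 0 < s) (hΔ0 : 0 < Δ)
    (hexp : Real.exp (2 * η * s) ≤ 2)
    (hRe1 : ∀ Z : 𝔸, ‖(τ : 𝔸 →ₗ[ℂ] ℂ) (Z * (reC (plaqU T U μ ν x) - 1))‖ ≤ ‖Z‖ * (η ^ 2 * κ))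
    (hIm : ∀ Z : 𝔸, ‖(τ : 𝔸 →ₗ[ℂ] ℂ) (Z * (((η : ℂ) ^ 2)⁻¹ • imC (plaqU T U μ ν x)))‖ ≤ ‖Z‖ * κ)
    (hW : ∀ Z : 𝔸, ‖(τ : 𝔸 →ₗ[ℂ] ℂ) (Z * (plaqU T U μ ν x : 𝔸))‖ ≤ ‖Z‖)
    (hW' : ∀ Z : 𝔸, ‖(τ : 𝔸 →ₗ[ℂ] ℂ) (Z * (((plaqU T U μ ν x)⁻¹ : 𝔸ˣ) : 𝔸))‖ ≤ ‖Z‖) :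
    ‖deriv (fun t : ℂ => V0p T U η (τ : 𝔸 →ₗ[ℂ] ℂ) (A + t • δ) μ ν x
        - (2 : ℂ)⁻¹ * I * (τ : 𝔸 →ₗ[ℂ] ℂ) (curlη T U η (A + t • δ) μ ν x
          * B11Eq34BCH.comm2 (-(R (U ν x) ((A + t • δ) μ (T ν x)))) (-((A + t • δ) ν x)) ((A + t • δ) μ x)
              (R (U μ x) ((A + t • δ) ν (T μ x))))) 0‖
      ≤ Δ * (8 * s ^ 2 * η * κ + 4 / 3 * s ^ 3) := by
  refine norm_deriv_le_of_majorant40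
    ((differentiable_V0p_line T U η τ A δ μ ν x).sub (differentiable_term39_line T U η τ A δ μ ν x)) hs0 hΔ0
    fun t ht => ?_
  -- on the circle `|t| = s/Δ` the size of the letters is `≤ s + |t|Δ = 2s`
  have hst : size (lettersA T U (A + t • δ) μ ν x) ≤ s + ‖t‖ * Δ :=
    (size_lettersA_add_smul_le T U A δ t μ ν x).trans (by gcongr)
  have h2s : s + ‖t‖ * Δ = 2 * s := by rw [ht, div_mul_cancel₀ s hΔ0.ne']; ring
  have hexp' : Real.exp (η * (s + ‖t‖ * Δ)) ≤ 2 := by rw [h2s, ← mul_assoc, mul_comm η 2]; exact hexp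
  exact ineq40_first_complex T U hU τ hτ hτs hη hκ (A + t • δ) μ ν x hst hexp' hRe1 hIm hW hW'

omit [LinearOrder ι] in
/-- **THE (90) ESTIMATE FOR THE V′₀-GROUP, END TO END** — `norm_deriv_V0prime_line_le` fed BY NAME into
`B11Eq90V0Derivative.ineq90_of_deriv40` at `κ = C₁B₃ε₁(Lʲη)⁻²` ((38)): with `n = #st(b)`, an operator bound `θ` for `𝔇*(A′)H*`,
`|A|(∂p) ≦ s ≦ 4x`, `Lʲη·x ≦ 2ε₃` ((57)), `η ≦ Lʲη = t`:
`n(1 + θ)|∂_{δA}V′₀(A, ∂p)| ≦ 8n(1 + θ)·128Δ·max{C₁B₃, 1}·ε₃²(ε₁ + ε₃)(Lʲη)⁻³` — «the functional derivative (90) can be estimated by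
O(1)ε₃²(ε₁ + ε₃)(Lʲη)⁻³ on Ω_j», for the V′₀-group, from print's data. [cite: Balaban1985Variational, (90) p.291] -/
theorem ineq90_V0prime [NormOneClass 𝔸] (hU : ∀ μ x, (((U μ x)⁻¹ : 𝔸ˣ) : 𝔸) = star (U μ x : 𝔸))
    (τ : 𝔸 →L[ℂ] ℂ) (hτ : ∀ a b : 𝔸, τ (a * b) = τ (b * a)) (hτs : ∀ a : 𝔸, τ (star a) = starRingEnd ℂ (τ a))
    {η : ℝ} (hη : 0 < η) {s Δ C₁B₃ ε₁ t : ℝ} (hC : 0 ≤ C₁B₃) (hε₁ : 0 ≤ ε₁) (ht : 0 < t)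
    (A δ : ι → S → 𝔸) (μ ν : ι) (x : S)
    (hs : size (lettersA T U A μ ν x) ≤ s) (hΔ : size (lettersA T U δ μ ν x) ≤ Δ) (hs0 : 0 < s) (hΔ0 : 0 < Δ)
    (hexp : Real.exp (2 * η * s) ≤ 2)
    (hRe1 : ∀ Z : 𝔸, ‖(τ : 𝔸 →ₗ[ℂ] ℂ) (Z * (reC (plaqU T U μ ν x) - 1))‖ ≤ ‖Z‖ * (η ^ 2 * (C₁B₃ * ε₁ / t ^ 2)))
    (hIm : ∀ Z : 𝔸, ‖(τ : 𝔸 →ₗ[ℂ] ℂ) (Z * (((η : ℂ) ^ 2)⁻¹ • imC (plaqU T U μ ν x)))‖ ≤ ‖Z‖ * (C₁B₃ * ε₁ / t ^ 2))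
    (hW : ∀ Z : 𝔸, ‖(τ : 𝔸 →ₗ[ℂ] ℂ) (Z * (plaqU T U μ ν x : 𝔸))‖ ≤ ‖Z‖)
    (hW' : ∀ Z : 𝔸, ‖(τ : 𝔸 →ₗ[ℂ] ℂ) (Z * (((plaqU T U μ ν x)⁻¹ : 𝔸ˣ) : 𝔸))‖ ≤ ‖Z‖)
    {n θ xA ε₃ : ℝ} (hn : 0 ≤ n) (hθ : 0 ≤ θ) (hx0 : 0 ≤ xA) (hx : t * xA ≤ 2 * ε₃) (hsx : s ≤ 4 * xA) (hηt : η ≤ t) :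
    n * (1 + θ) * ‖deriv (fun t : ℂ => V0p T U η (τ : 𝔸 →ₗ[ℂ] ℂ) (A + t • δ) μ ν x
        - (2 : ℂ)⁻¹ * I * (τ : 𝔸 →ₗ[ℂ] ℂ) (curlη T U η (A + t • δ) μ ν x
          * B11Eq34BCH.comm2 (-(R (U ν x) ((A + t • δ) μ (T ν x)))) (-((A + t • δ) ν x)) ((A + t • δ) μ x)
              (R (U μ x) ((A + t • δ) ν (T μ x))))) 0‖
      ≤ 8 * n * (1 + θ) * (128 * Δ) * max C₁B₃ 1 * ε₃ ^ 2 * (ε₁ + ε₃) / t ^ 3 :=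
  ineq90_of_deriv40 n θ Δ C₁B₃ ε₁ ε₃ t xA _ s η ht hn hθ hΔ0.le hC hε₁ hx0 hx hs0.le hsx hη.le hηt
    (norm_deriv_V0prime_line_le T U hU τ hτ hτs hη (by positivity) A δ μ ν x hs hΔ hs0 hΔ0 hexp hRe1 hIm hW hW')

end Literature.MathematicalPhysics.QuantumFieldTheory.Balaban1983to89.B11Eq36Complex
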